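import Summits.RiemannHypothesis.RiemannHypothesis.Theorems.SoloInformedGroundStateWindowFn

/-!
# Ground-state endgame, XV: the window test with explicit constants

Solo programme `solo-RiemannHypothesis-informed`, session 2 (claim C28). Quantitative forms of the
two estimates of part IX for a general seed `h` (even, Schwartz, `h(0) = 0 = ∫ h`, `supp h ⊆ [-1,1]`):
if the E-map image obeys the LINEAR bound `‖S_λ(u)‖ ≤ A' u/λ` on the leak window `(0, 2/(λ+1)]`
(which part XII supplies with `A'` explicit in `𝓕h`), then

* `‖ĝ_λ(ρ)‖ ≤ 2A'/λ²` at every non-trivial zero `ρ`, wherever it lies;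
* `‖ĝ_λ(2)‖ ≥ (π²/6) ‖𝓜h(2)‖ λ² − 2A'/λ²`.
-/

noncomputable section

open Complex Filter Set Topology MeasureTheory
open Literature.NumberTheory.LFunctions

namespace Summit.RiemannHypothesis.RiemannHypothesis.Theorems

section quant

variable (h : SchwartzMap ℝ ℂ) (heven : ∀ x, h (-x) = h x) (h0 : h 0 = 0)
  (hint : ∫ x : ℝ, h x = 0) (hsupp : ∀ x : ℝ, 1 < x → h x = 0)

/-- **Quantitative tail bound.** If `‖S_λ(u)‖ ≤ A' u/λ` for `0 < u ≤ 2/(λ+1)` (`λ ≥ 1`), then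
`‖𝓜(tail)(s)‖ ≤ 2A'/λ²` for every `s` with `Re s > 0`. -/
theorem norm_mellin_tailFn_le_of_bound {A' lam : ℝ} (hA' : 0 ≤ A') (hlam : 1 ≤ lam)
    (hE : ∀ u : ℝ, 0 < u → u ≤ 2 / (lam + 1) → ‖eMapFn h lam u‖ ≤ A' * (lam⁻¹ * u))
    {s : ℂ} (hs : 0 < s.re) :
    ‖mellin (tailFn h lam) s‖ ≤ 2 * A' / lam ^ 2 := by
  have hlam0 : 0 < lam := by linarith
  set U : ℝ := 2 / (lam + 1) with hU
  have hU0 : 0 < U := by positivity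
  have hU1 : U ≤ 1 := by rw [hU, div_le_one (by linarith)]; linarith
  have hM : 0 ≤ A' * lam⁻¹ := by positivity
  have hb : ∀ u : ℝ, 0 < u → u ≤ U → ‖tailFn h lam u‖ ≤ A' * lam⁻¹ * u ^ (1 : ℝ) := by
    intro u hu huU
    calc ‖tailFn h lam u‖ ≤ ‖eMapFn h lam u‖ := norm_tailFn_le h lam u
      _ ≤ A' * (lam⁻¹ * u) := hE u hu huU
      _ = A' * lam⁻¹ * u ^ (1 : ℝ) := by rw [Real.rpow_one]; ring
  have hz : ∀ u : ℝ, U < u → tailFn h lam u = 0 := by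
    intro u hu
    refine tailFn_eq_zero_of_le h ?_
    have hUe : (lam + 1) * U = 2 := by rw [hU]; field_simp
    calc (2 : ℝ) = (lam + 1) * U := hUe.symm
      _ ≤ (lam + 1) * u := mul_le_mul_of_nonneg_left hu.le (by linarith)
  have hKs : 0 < 1 + s.re := by linarith
  have key := norm_mellin_le_of_pow_decay hU0 zero_le_one hb hz hs
  have hUp : U ^ (1 + s.re) ≤ U := by
    calc U ^ (1 + s.re) ≤ U ^ (1 : ℝ) := Real.rpow_le_rpow_of_exponent_ge hU0 hU1 (by linarith)
      _ = U := Real.rpow_one U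
  have h1 : A' * lam⁻¹ * U ^ (1 + s.re) / (1 + s.re) ≤ A' * lam⁻¹ * U ^ (1 + s.re) :=
    div_le_self (by positivity) (by linarith)
  have h2 : A' * lam⁻¹ * U ^ (1 + s.re) ≤ A' * lam⁻¹ * U := mul_le_mul_of_nonneg_left hUp hM
  have h3 : A' * lam⁻¹ * U ≤ 2 * A' / lam ^ 2 := by
    rw [hU, show A' * lam⁻¹ * (2 / (lam + 1)) = 2 * A' / (lam * (lam + 1)) by field_simp]
    exact div_le_div_of_nonneg_left (by positivity) (by positivity) (by nlinarith)
  linarith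

include heven h0 hint hsupp

/-- **THE WINDOW TEST IS SMALL AT EVERY ZERO, quantitatively**: under the linear bound on the leak
window, `‖ĝ_λ(ρ)‖ ≤ 2A'/λ²` at every non-trivial zero `ρ`. -/
theorem norm_weilMellin_winTest_le_of_bound {A' lam : ℝ} (hA' : 0 ≤ A') (hlam : 1 ≤ lam)
    (hE : ∀ u : ℝ, 0 < u → u ≤ 2 / (lam + 1) → ‖eMapFn h lam u‖ ≤ A' * (lam⁻¹ * u))
    {ρ : ℂ} (hρ : ρ ∈ ZetaZeros.riemannZetaNontrivialZeros) :
    ‖weilMellin (winTest h lam) ρ‖ ≤ 2 * A' / lam ^ 2 := by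
  obtain ⟨hζ, hre, hre1⟩ := mem_riemannZetaNontrivialZeros_iff_holds.1 hρ
  have hρ1 : ρ ≠ 1 := by
    rintro rfl
    simp at hre1
  rw [weilMellin_winTest, mellin_winFn_eq_neg h heven h0 hint hsupp (by linarith) hre hρ1 hζ, norm_neg]
  exact norm_mellin_tailFn_le_of_bound h hA' hlam hE hre

/-- **THE WINDOW TEST IS LARGE AT `s = 2`, quantitatively**:
`‖ĝ_λ(2)‖ ≥ (π²/6) ‖𝓜h(2)‖ λ² − 2A'/λ²`. -/
theorem norm_weilMellin_winTest_two_ge_of_bound {A' lam : ℝ} (hA' : 0 ≤ A') (hlam : 1 ≤ lam)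
    (hE : ∀ u : ℝ, 0 < u → u ≤ 2 / (lam + 1) → ‖eMapFn h lam u‖ ≤ A' * (lam⁻¹ * u)) :
    Real.pi ^ 2 / 6 * ‖mellin (fun x : ℝ => h x) 2‖ * lam ^ 2 - 2 * A' / lam ^ 2
      ≤ ‖weilMellin (winTest h lam) 2‖ := by
  have hlam0 : 0 < lam := by linarith
  have h2 : 0 < (2 : ℂ).re := by norm_num
  have h2' : 1 < (2 : ℂ).re := by norm_num
  rw [weilMellin_winTest, mellin_winFn_eq h heven h0 hint hsupp hlam0 h2, mellin_eMapFn_eq h hlam0 h2',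
    riemannZeta_two]
  set A : ℂ := (lam : ℂ) ^ (2 : ℂ) * ((Real.pi : ℂ) ^ 2 / 6) * mellin (fun x : ℝ => h x) 2
  set B : ℂ := mellin (tailFn h lam) 2
  have hB : ‖B‖ ≤ 2 * A' / lam ^ 2 := norm_mellin_tailFn_le_of_bound h hA' hlam hE h2
  have hA : ‖A‖ = Real.pi ^ 2 / 6 * ‖mellin (fun x : ℝ => h x) 2‖ * lam ^ 2 := by
    have hn : ‖(lam : ℂ) ^ (2 : ℂ)‖ = lam ^ 2 := by
      rw [Complex.norm_cpow_eq_rpow_re_of_pos hlam0, show (2 : ℂ).re = (2 : ℝ) by norm_num,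
        Real.rpow_two]
    have hπ : ‖((Real.pi : ℂ) ^ 2 / 6)‖ = Real.pi ^ 2 / 6 := by
      rw [norm_div, norm_pow, Complex.norm_real, Real.norm_of_nonneg Real.pi_pos.le]
      norm_num
    simp only [A, norm_mul, hn, hπ]
    ring
  calc Real.pi ^ 2 / 6 * ‖mellin (fun x : ℝ => h x) 2‖ * lam ^ 2 - 2 * A' / lam ^ 2
      ≤ ‖A‖ - ‖B‖ := by rw [hA]; linarith
    _ ≤ ‖A - B‖ := norm_sub_norm_le A B

end quant

end Summit.RiemannHypothesis.RiemannHypothesis.Theorems
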